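import Literature.NumberTheory.Rogawski1990.AdelicKappaOrbitalEulerDischargeGp
import Literature.NumberTheory.Rogawski1990.AdelicStableOrbitalEulerDischargeH
import HarnessLib

/-!
# G2 ASSEMBLY — the adelic `κ`-identity `Φ^{κ,𝐀}_{G′}(γ_H; f′) = Φ^{st,𝐀}_H(γ_H; f′^H)` for the inner form: `κ`-side Euler product (G′) × Δ-transfer place by place ×
# `H`-side Euler product, assembled (Rogawski (1990), §4.3 (4.3.1)–(4.3.3) pp. 43–44 «hence `Φ^κ(γ, f) = Φ^{st}(γ_H, f^H)`, where `f^H = Π_v f^H_v`»; §14.3 pp. 233–234;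
# §14.5 Thm. 14.5.1 (a) p. 238, the regular elliptic step «we refer to [L₂]»; Kottwitz (1986) Prop. 7.1; Langlands (1983))

Topic `NumberTheory/Rogawski1990`; namespace `Literature.NumberTheory.Rogawski1990`.  THEOREMS ONLY: no definition, no named fact, no instance, no notation, no
`sorry`.  Cell `pub/hodgecm-mathlib`, ENGINE T1 (crux item stmt-HodgeConjecture-24833), PLAN-T1 (g4) §1 O11-0 gap **G2 «κ ≠ 1 ∕ Δ-transfer to `H`, adelic ASSEMBLY»**
(F0P3a-plan (g4) GO #94 (2); census A-p01 (g14) 06:19Z).  The three ★ inputs, BY NAME: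

* (i) the `G′`-side `κ`-twisted Euler DISCHARGE with Δ-transfer ★ (E3-G′κ) part 2 `MatchingAdele.exists_adelicKappaOrbitalIntegralG'_ofLocalAdelic_eq_archStableSideH_mul_prod`
  (`AdelicKappaOrbitalEulerDischargeGp` §4): `∃ S₁, ∀ S ⊇ S₁, Σᶠ_{c ∈ 𝒞_𝐀(γ_H)} w c · Φ_{ofLocalAdelic mG mGi}(c, T.eval) = Φ^st_{H,∞} · ∏_{v ∈ S} Φ^st_{H,v}` (over ★ part 1, ★ A-p06
  `AdelicDeltaTransfer` `localKappaSide_eq_localStableSideH` ∕ `archKappaSide_eq_archStableSideH`, pin (xi‴) `IsLocalDeltaTransfer`, `IsArchDeltaTransfer`);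
* (ii) the `H`-side Euler DISCHARGE ★ (E3c-H) `MatchingAdeleH.exists_isEulerOnClasses_ofLocalAdelicPair[_of_isCanonical']` (`AdelicStableOrbitalEulerDischargeH`):
  `∃ S₂, ∀ S ⊇ S₂, Σᶠ_{c ∈ 𝒞′_𝐀(γ_H)} Φ_{ofLocalAdelicPair mH mHi}(c, T^H.eval) = Φ^st_{H,∞} · ∏_{v ∈ S} Φ^st_{H,v}` (★ `IsEulerOnClasses`);
* (iii) the glue: ★ `isEulerOnClasses_iff`, ★ `adelicStableOrbitalIntegralH` (= `adelicStableOrbitalSum (adelicStableClassesOverH …)` by `rfl`), and the DEFINITIONAL identities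
  `localStableSideH L v mH T^H.loc γ_H = stableOrbitalIntegralRel (IsLocalStablyConjH L v) (mH v) (T^H.loc v) (rationalComponent L γ_H v)`,
  `archStableSideH L mHi T^H.arch γ_H = stableOrbitalIntegralRel (IsArchStablyConjH L) mHi T^H.arch (rationalArch L γ_H)` (★ `rationalComponent`, ★ `rationalArch` ARE the
  component pairs; `rfl`).

WHAT IS PROVED (take `S := S₁ ∪ S₂`; both sides equal `Φ^st_{H,∞} · ∏_{v ∈ S} Φ^st_{H,v}`):
* §1 **`MatchingAdele.adelicKappaOrbitalIntegralG'_eq_adelicStableOrbitalIntegralH_of_isEulerOnClasses`** — the ASSEMBLY in its honest generality: the `G′`-side hypotheses of (i)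
  VERBATIM and, on the `H` side, ANY adelic family `mHA` on `H(𝐀)` and function `f^H_𝐀` that are EVENTUALLY EULER on `𝒞′_𝐀(γ_H)` with local ∕ archimedean factors the stable
  `H`-sides of the SAME `(mH, mHi, f^H_v, f^H_∞)` ⟹ `Φ^{κ,𝐀}_{G′}(γ_H; w; ofLocalAdelic mG mGi; T.eval) = Φ^{st,𝐀}_H(γ_H; mHA; f^H_𝐀)`.
* §2 **`MatchingAdele.adelicKappaOrbitalIntegralG'_ofLocalAdelic_eq_adelicStableOrbitalIntegralH_ofLocalAdelicPair`** — (i) ∪ (ii) literally: the `H`-side family is ★ «C-H»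
  `OrbitalMeasureFamily.ofLocalAdelicPair L Φ₂ Φ₁ mH mHi` and `f^H_𝐀 = T^H.eval` for an unramified ★ `PureTensor₂` with `T^H.loc = f^H`, `T^H.arch = f^H_∞` the Δ-transfers of
  `T.loc`, `T.arch`; general (admissible ∕ normalised) hypotheses as in (i) and the general (ii).
* §3 **`…_of_isCanonical`** — the same with every analytic hypothesis DISCHARGED for CANONICAL local families on both groups (pins (xi‴), (ix′) of the engine line):
  ★ (E3-G′κ) §5 `MatchingAdele.exists_adelicKappaOrbitalIntegralG'_ofLocalAdelic_eq_of_isCanonical` × ★ A-p06 §4 × ★ (E3c-H) `…_of_isCanonical'` — only pin-shaped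
  hypotheses remain (`G`-regular rational `γ_H` with a rational image `γ₀ ∈ G′(L⁺)`, `Δ` a.e. trivial with the class weight `w` READING ★ `adelicFactor`, canonical `mG`, `mH`
  for Haar measures giving the hyperspecial levels mass `1`, admissible archimedean families, the pure tensors `T`, `T^H` with `IsLocalDeltaTransfer` at every finite
  place and `IsArchDeltaTransfer` at `∞`).
* §4 **`…_of_globalKappaFormula`** — the class weight spelled as print does, `w [γ̄] = κ(obs γ̄)` (★ NAMED FACT (4.3.3) `GlobalKappaFormula` turns it into the ★ `adelicFactor` reading).
HONEST LABEL.  HC_CM is proved only modulo the printed citations until rung 0 closes; this file is unconditional modulo its displayed hypotheses (no named fact is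
consumed except in §4, where (4.3.3) is an explicit hypothesis).  The `κ = 1` companion (G1, inner transfer) is A-p04's `AdelicInnerTransferAssembly`; the pre-stabilisation
(`Σ_κ`, Hasse) is the LEAD's posited per-`γ₀` package (RULING #91 #2) — neither is touched here.

## References
* [Rogawski1990] J. D. Rogawski, *Automorphic Representations of Unitary Groups in Three Variables*, Ann. of Math. Stud. 123 (1990), §4.3 (4.3.1)–(4.3.3) pp. 43–44,
  §5.4 (5.4.2)–(5.4.3) pp. 72–73, §14.3 pp. 233–234, §14.5 Thm. 14.5.1 (a) p. 238.
* [Kottwitz1986] R. E. Kottwitz, *Stable trace formula: elliptic singular terms*, Math. Ann. 275 (1986), Prop. 7.1, §7.3.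
* [Langlands1983] R. P. Langlands, *Les débuts d'une formule des traces stable*, Publ. Math. Univ. Paris VII 13 (1983).
-/

set_option autoImplicit false

noncomputable section

open NumberField IsDedekindDomain Filter Function MeasureTheory
open scoped Matrix MatrixGroups

namespace Literature.NumberTheory.Rogawski1990

open Literature.NumberTheory.Automorphic Literature.NumberTheory.Automorphic.UnitaryGroup Literature.MeasureTheory.Group

section Assembly

variable {L : Type} [Field L] [NumberField L] [IsCMField L] {H' : Matrix (Fin 3) (Fin 3) L}
  {γH : (UnitaryGroup.cmDatum L 2 (Matrix.of fun i j : Fin 2 => if i.val + j.val + 1 = 2 then (1 : L) else 0)).Rational × (UnitaryGroup.cmDatum L 1 (Matrix.of fun i j : Fin 1 => if i.val + j.val + 1 = 1 then (1 : L) else 0)).Rational}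
  -- `G′(𝐀)`, `G′_v`, `G′_∞` orbit quotients (as in ★ (E3-G′κ))
  [∀ g : (UnitaryGroup.cmDatum L 3 H').Adelic,
    MeasurableSpace ((UnitaryGroup.cmDatum L 3 H').Adelic ⧸ Subgroup.centralizer ({g} : Set (UnitaryGroup.cmDatum L 3 H').Adelic))]
  [∀ g : (UnitaryGroup.cmDatum L 3 H').Adelic,
    BorelSpace ((UnitaryGroup.cmDatum L 3 H').Adelic ⧸ Subgroup.centralizer ({g} : Set (UnitaryGroup.cmDatum L 3 H').Adelic))]
  [∀ (v : HeightOneSpectrum (𝓞 ↥(maximalRealSubfield L))) (x : (UnitaryGroup.cmDatum L 3 H').Local v),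
    MeasurableSpace ((UnitaryGroup.cmDatum L 3 H').Local v ⧸ Subgroup.centralizer ({x} : Set ((UnitaryGroup.cmDatum L 3 H').Local v)))]
  [∀ (v : HeightOneSpectrum (𝓞 ↥(maximalRealSubfield L))) (x : (UnitaryGroup.cmDatum L 3 H').Local v),
    BorelSpace ((UnitaryGroup.cmDatum L 3 H').Local v ⧸ Subgroup.centralizer ({x} : Set ((UnitaryGroup.cmDatum L 3 H').Local v)))]
  [∀ a : UnitaryGroup.arch (↥(maximalRealSubfield L)) L (IsCMField.complexConj L) 3 H',
    MeasurableSpace (UnitaryGroup.arch (↥(maximalRealSubfield L)) L (IsCMField.complexConj L) 3 H' ⧸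
      Subgroup.centralizer ({a} : Set (UnitaryGroup.arch (↥(maximalRealSubfield L)) L (IsCMField.complexConj L) 3 H')))]
  [∀ a : UnitaryGroup.arch (↥(maximalRealSubfield L)) L (IsCMField.complexConj L) 3 H',
    BorelSpace (UnitaryGroup.arch (↥(maximalRealSubfield L)) L (IsCMField.complexConj L) 3 H' ⧸
      Subgroup.centralizer ({a} : Set (UnitaryGroup.arch (↥(maximalRealSubfield L)) L (IsCMField.complexConj L) 3 H')))]
  -- `H(𝐀)`, `H_v`, `H_∞` orbit quotients (as in ★ (E3c-H); ★ «C-H» `pairAdelic` ∕ `pairLocal` ∕ `pairArch` are the product carriers, reducibly)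
  [∀ h : pairAdelic L (Matrix.of fun i j : Fin 2 => if i.val + j.val + 1 = 2 then (1 : L) else 0) (Matrix.of fun i j : Fin 1 => if i.val + j.val + 1 = 1 then (1 : L) else 0), MeasurableSpace (pairAdelic L (Matrix.of fun i j : Fin 2 => if i.val + j.val + 1 = 2 then (1 : L) else 0) (Matrix.of fun i j : Fin 1 => if i.val + j.val + 1 = 1 then (1 : L) else 0) ⧸ Subgroup.centralizer ({h} : Set (pairAdelic L (Matrix.of fun i j : Fin 2 => if i.val + j.val + 1 = 2 then (1 : L) else 0) (Matrix.of fun i j : Fin 1 => if i.val + j.val + 1 = 1 then (1 : L) else 0))))]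
  [∀ (v : HeightOneSpectrum (𝓞 ↥(maximalRealSubfield L))) (x : pairLocal L (Matrix.of fun i j : Fin 2 => if i.val + j.val + 1 = 2 then (1 : L) else 0) (Matrix.of fun i j : Fin 1 => if i.val + j.val + 1 = 1 then (1 : L) else 0) v),
    MeasurableSpace (pairLocal L (Matrix.of fun i j : Fin 2 => if i.val + j.val + 1 = 2 then (1 : L) else 0) (Matrix.of fun i j : Fin 1 => if i.val + j.val + 1 = 1 then (1 : L) else 0) v ⧸ Subgroup.centralizer ({x} : Set (pairLocal L (Matrix.of fun i j : Fin 2 => if i.val + j.val + 1 = 2 then (1 : L) else 0) (Matrix.of fun i j : Fin 1 => if i.val + j.val + 1 = 1 then (1 : L) else 0) v)))]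
  [∀ a : pairArch L (Matrix.of fun i j : Fin 2 => if i.val + j.val + 1 = 2 then (1 : L) else 0) (Matrix.of fun i j : Fin 1 => if i.val + j.val + 1 = 1 then (1 : L) else 0), MeasurableSpace (pairArch L (Matrix.of fun i j : Fin 2 => if i.val + j.val + 1 = 2 then (1 : L) else 0) (Matrix.of fun i j : Fin 1 => if i.val + j.val + 1 = 1 then (1 : L) else 0) ⧸ Subgroup.centralizer ({a} : Set (pairArch L (Matrix.of fun i j : Fin 2 => if i.val + j.val + 1 = 2 then (1 : L) else 0) (Matrix.of fun i j : Fin 1 => if i.val + j.val + 1 = 1 then (1 : L) else 0))))]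

/-! ## §1 The assembly in its honest generality: ANY eventually-Euler `H`-side adelic family -/

/-- **G2 ASSEMBLY — `Φ^{κ,𝐀}_{G′}(γ_H; f′) = Φ^{st,𝐀}_H(γ_H; f′^H)`.**  `G′ = U(H′)`, `H = U(Φ₂) × U(Φ₁)`, `γ_H ∈ H(L⁺)` rational and `G`-regular with a rational image
`γ₀ ∈ G′(L⁺)`.  `G′` SIDE (the hypotheses of ★ (E3-G′κ) `…_eq_archStableSideH_mul_prod` VERBATIM): local transfer factors `Δ` a.e. trivial on matching pairs, archimedean
factor `Tinf`, class weight `w` reading ★ `adelicFactor`, local ∕ archimedean families `mG`, `mGi` admissible on the regular classes with `mG` normalised at `toAdelic γ₀`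
and at every matching adèle, an `IsTest` pure tensor `T` with integrable orbital integrands on `𝒞_𝐀(γ_H)`, and Δ-TRANSFERS `f^H_v` of `T.loc v` at EVERY finite `v`
(★ `IsLocalDeltaTransfer`, pin (xi‴)) and `f^H_∞` of `T.arch` (★ `IsArchDeltaTransfer`) for `H`-families `mH`, `mHi`.  `H` SIDE: ANY class-indexed adelic family `mHA` on
`H(𝐀)` and function `f^H_𝐀` that are EVENTUALLY EULER on `𝒞′_𝐀(γ_H)` (★ `IsEulerOnClasses`) with local ∕ archimedean factors the STABLE `H`-sides of the same
`(mH v, f^H_v)`, `(mHi, f^H_∞)` at `(γ_H)_v`, `γ_H ⊗ 1`.  THEN `Σᶠ_{c ∈ 𝒞_𝐀(γ_H)} w c · Φ_{ofLocalAdelic mG mGi}(c, T.eval) = Φ^{st,𝐀}_H(γ_H; mHA; f^H_𝐀)` — both are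
`Φ^st_{H,∞}(γ_H ⊗ 1, f^H_∞) · ∏_{v ∈ S₁ ∪ S₂} Φ^st_{H,v}((γ_H)_v, f^H_v)`.
[cite: Rogawski1990, §4.3 (4.3.1)–(4.3.3) pp. 43–44; §14.3 pp. 233–234; §14.5 Thm. 14.5.1 (a) p. 238] [cite: Kottwitz1986, Prop. 7.1] [cite: Langlands1983] -/
theorem MatchingAdele.adelicKappaOrbitalIntegralG'_eq_adelicStableOrbitalIntegralH_of_isEulerOnClasses
    (hH' : (H'.map (cmConjRingHom L))ᵀ = H') (hdet : H'.det ≠ 0)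
    (hreg : IsGRegular (cmConjRingHom L) (Matrix.of fun i j : Fin 2 => if i.val + j.val + 1 = 2 then (1 : L) else 0) (Matrix.of fun i j : Fin 1 => if i.val + j.val + 1 = 1 then (1 : L) else 0) (Matrix.of fun i j : Fin 3 => if i.val + j.val + 1 = 3 then (1 : L) else 0) endoForm_antidiagOne γH)
    {γ₀ : (UnitaryGroup.cmDatum L 3 H').Rational} (hγ : IsNormPair L H' γH γ₀)
    (Δ : ∀ v : HeightOneSpectrum (𝓞 ↥(maximalRealSubfield L)), LocalTransferFactor L H' v) (hΔ : IsAlmostEverywhereTrivial L H' Δ)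
    (Tinf : ArchTransferFactor L H')
    (w : ConjClasses (UnitaryGroup.cmDatum L 3 H').Adelic → ℂ)
    (hw : ∀ p : MatchingAdele L H' γH, w (ConjClasses.mk p.adele) = adelicFactor L H' Δ Tinf.Δ γH p)
    (mG : ∀ v : HeightOneSpectrum (𝓞 ↥(maximalRealSubfield L)), OrbitalMeasureFamily ((UnitaryGroup.cmDatum L 3 H').Local v))
    (mGi : OrbitalMeasureFamily (UnitaryGroup.arch (↥(maximalRealSubfield L)) L (IsCMField.complexConj L) 3 H'))
    (hadm : ∀ v, (mG v).IsAdmissibleOn fun x => IsRegularElt (x.val : GL (Fin 3) (UnitaryGroup.LocalRing L v)))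
    (hadmA : mGi.IsAdmissibleOn fun a => IsRegularElt (a.val : GL (Fin 3) (mixedEmbedding.mixedSpace L)))
    (hnormγ : ∃ S₀ : Finset (HeightOneSpectrum (𝓞 ↥(maximalRealSubfield L))),
      UnitaryGroup.IsNormalisedOff L 3 H' mG ((UnitaryGroup.cmDatum L 3 H').toAdelic γ₀) S₀)
    (hnorm : ∀ p : MatchingAdele L H' γH, ∃ S₀ : Finset (HeightOneSpectrum (𝓞 ↥(maximalRealSubfield L))),
      UnitaryGroup.IsNormalisedOff L 3 H' mG p.adele S₀)
    (T : UnitaryGroup.PureTensor L 3 H') (hT : T.IsTest)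
    (hFi : ∀ c ∈ adelicStableClassesOver L H' γH, Integrable
      (descConj (Quotient.out c : (UnitaryGroup.cmDatum L 3 H').Adelic)
        (Subgroup.centralizer ({(Quotient.out c : (UnitaryGroup.cmDatum L 3 H').Adelic)} : Set (UnitaryGroup.cmDatum L 3 H').Adelic))
        (centralizer_comm _) T.eval)
      (UnitaryGroup.OrbitalMeasureFamily.ofLocalAdelic L 3 H' mG mGi c))
    (mH : ∀ v : HeightOneSpectrum (𝓞 ↥(maximalRealSubfield L)), OrbitalMeasureFamily (pairLocal L (Matrix.of fun i j : Fin 2 => if i.val + j.val + 1 = 2 then (1 : L) else 0) (Matrix.of fun i j : Fin 1 => if i.val + j.val + 1 = 1 then (1 : L) else 0) v))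
    (mHi : OrbitalMeasureFamily (pairArch L (Matrix.of fun i j : Fin 2 => if i.val + j.val + 1 = 2 then (1 : L) else 0) (Matrix.of fun i j : Fin 1 => if i.val + j.val + 1 = 1 then (1 : L) else 0)))
    (fH : ∀ v : HeightOneSpectrum (𝓞 ↥(maximalRealSubfield L)), pairLocal L (Matrix.of fun i j : Fin 2 => if i.val + j.val + 1 = 2 then (1 : L) else 0) (Matrix.of fun i j : Fin 1 => if i.val + j.val + 1 = 1 then (1 : L) else 0) v → ℂ)
    (fHi : pairArch L (Matrix.of fun i j : Fin 2 => if i.val + j.val + 1 = 2 then (1 : L) else 0) (Matrix.of fun i j : Fin 1 => if i.val + j.val + 1 = 1 then (1 : L) else 0) → ℂ)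
    (hloc : ∀ v, IsLocalDeltaTransfer L H' v (Δ v) (mH v) (mG v) (fH v) (T.loc v))
    (harch : IsArchDeltaTransfer L H' Tinf mHi mGi fHi T.arch)
    (mHA : OrbitalMeasureFamily (pairAdelic L (Matrix.of fun i j : Fin 2 => if i.val + j.val + 1 = 2 then (1 : L) else 0) (Matrix.of fun i j : Fin 1 => if i.val + j.val + 1 = 1 then (1 : L) else 0))) (fHA : pairAdelic L (Matrix.of fun i j : Fin 2 => if i.val + j.val + 1 = 2 then (1 : L) else 0) (Matrix.of fun i j : Fin 1 => if i.val + j.val + 1 = 1 then (1 : L) else 0) → ℂ)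
    (hEulerH : ∃ S₂ : Finset (HeightOneSpectrum (𝓞 ↥(maximalRealSubfield L))), ∀ S : Finset (HeightOneSpectrum (𝓞 ↥(maximalRealSubfield L))), S₂ ⊆ S →
      IsEulerOnClasses (adelicStableClassesOverH L γH) mHA fHA S (fun v => localStableSideH L v mH fH γH) (archStableSideH L mHi fHi γH)) :
    adelicKappaOrbitalIntegralG' L H' γH w (UnitaryGroup.OrbitalMeasureFamily.ofLocalAdelic L 3 H' mG mGi) T.eval =
      adelicStableOrbitalIntegralH L γH mHA fHA := by
  classical
  obtain ⟨S₁, hS₁⟩ := MatchingAdele.exists_adelicKappaOrbitalIntegralG'_ofLocalAdelic_eq_archStableSideH_mul_prod hH' hdet hreg hγ Δ hΔ Tinf w hw mG mGi hadm hadmA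
    hnormγ hnorm T hT hFi mH mHi fH fHi hloc harch
  obtain ⟨S₂, hS₂⟩ := hEulerH
  have h₁ := hS₁ (S₁ ∪ S₂) Finset.subset_union_left
  have h₂ := hS₂ (S₁ ∪ S₂) Finset.subset_union_right
  rw [isEulerOnClasses_iff] at h₂
  rw [h₁, adelicStableOrbitalIntegralH, h₂]

/-! ## §2 With the `H`-side family BUILT FROM LOCAL FAMILIES (★ «C-H» `ofLocalAdelicPair`) and an unramified pure tensor `T^H` -/

/-- **G2 at `ofLocalAdelicPair mH mHi` and a pure tensor `T^H` with `T^H.loc = f^H`, `T^H.arch = f^H_∞`** — (i) ∪ (ii) literally: the `G′`-side hypotheses of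
★ (E3-G′κ) §4 and the `H`-side hypotheses of the general ★ (E3c-H) `MatchingAdeleH.exists_isEulerOnClasses_ofLocalAdelicPair` (admissible `mH`, `mHi` on the `G`-regular classes,
normalised at every `H`-matching adèle, the [Kt₄] Prop. 7.1 clause `hP`, integrable orbital integrands `hFiH`, unit local factors `h1`), the local ∕ archimedean factors
of `T^H` being the Δ-transfers of those of `T`.  THEN `Φ^{κ,𝐀}_{G′}(γ_H; w; ofLocalAdelic mG mGi; T.eval) = Φ^{st,𝐀}_H(γ_H; ofLocalAdelicPair mH mHi; T^H.eval)`.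
[cite: Rogawski1990, §4.3 (4.3.1)–(4.3.3) pp. 43–44; §5.4 (5.4.3) pp. 72–73; §14.5 Thm. 14.5.1 (a) p. 238] [cite: Kottwitz1986, Prop. 7.1, Cor. 7.3] -/
theorem MatchingAdele.adelicKappaOrbitalIntegralG'_ofLocalAdelic_eq_adelicStableOrbitalIntegralH_ofLocalAdelicPair
      [∀ h : pairAdelic L (Matrix.of fun i j : Fin 2 => if i.val + j.val + 1 = 2 then (1 : L) else 0) (Matrix.of fun i j : Fin 1 => if i.val + j.val + 1 = 1 then (1 : L) else 0), BorelSpace (pairAdelic L (Matrix.of fun i j : Fin 2 => if i.val + j.val + 1 = 2 then (1 : L) else 0) (Matrix.of fun i j : Fin 1 => if i.val + j.val + 1 = 1 then (1 : L) else 0) ⧸ Subgroup.centralizer ({h} : Set (pairAdelic L (Matrix.of fun i j : Fin 2 => if i.val + j.val + 1 = 2 then (1 : L) else 0) (Matrix.of fun i j : Fin 1 => if i.val + j.val + 1 = 1 then (1 : L) else 0))))]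
    [∀ (v : HeightOneSpectrum (𝓞 ↥(maximalRealSubfield L))) (x : pairLocal L (Matrix.of fun i j : Fin 2 => if i.val + j.val + 1 = 2 then (1 : L) else 0) (Matrix.of fun i j : Fin 1 => if i.val + j.val + 1 = 1 then (1 : L) else 0) v),
      BorelSpace (pairLocal L (Matrix.of fun i j : Fin 2 => if i.val + j.val + 1 = 2 then (1 : L) else 0) (Matrix.of fun i j : Fin 1 => if i.val + j.val + 1 = 1 then (1 : L) else 0) v ⧸ Subgroup.centralizer ({x} : Set (pairLocal L (Matrix.of fun i j : Fin 2 => if i.val + j.val + 1 = 2 then (1 : L) else 0) (Matrix.of fun i j : Fin 1 => if i.val + j.val + 1 = 1 then (1 : L) else 0) v)))]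
    [∀ a : pairArch L (Matrix.of fun i j : Fin 2 => if i.val + j.val + 1 = 2 then (1 : L) else 0) (Matrix.of fun i j : Fin 1 => if i.val + j.val + 1 = 1 then (1 : L) else 0), BorelSpace (pairArch L (Matrix.of fun i j : Fin 2 => if i.val + j.val + 1 = 2 then (1 : L) else 0) (Matrix.of fun i j : Fin 1 => if i.val + j.val + 1 = 1 then (1 : L) else 0) ⧸ Subgroup.centralizer ({a} : Set (pairArch L (Matrix.of fun i j : Fin 2 => if i.val + j.val + 1 = 2 then (1 : L) else 0) (Matrix.of fun i j : Fin 1 => if i.val + j.val + 1 = 1 then (1 : L) else 0))))]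
    (hH' : (H'.map (cmConjRingHom L))ᵀ = H') (hdet : H'.det ≠ 0)
    (hreg : IsGRegular (cmConjRingHom L) (Matrix.of fun i j : Fin 2 => if i.val + j.val + 1 = 2 then (1 : L) else 0) (Matrix.of fun i j : Fin 1 => if i.val + j.val + 1 = 1 then (1 : L) else 0) (Matrix.of fun i j : Fin 3 => if i.val + j.val + 1 = 3 then (1 : L) else 0) endoForm_antidiagOne γH)
    {γ₀ : (UnitaryGroup.cmDatum L 3 H').Rational} (hγ : IsNormPair L H' γH γ₀)
    (Δ : ∀ v : HeightOneSpectrum (𝓞 ↥(maximalRealSubfield L)), LocalTransferFactor L H' v) (hΔ : IsAlmostEverywhereTrivial L H' Δ)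
    (Tinf : ArchTransferFactor L H')
    (w : ConjClasses (UnitaryGroup.cmDatum L 3 H').Adelic → ℂ)
    (hw : ∀ p : MatchingAdele L H' γH, w (ConjClasses.mk p.adele) = adelicFactor L H' Δ Tinf.Δ γH p)
    (mG : ∀ v : HeightOneSpectrum (𝓞 ↥(maximalRealSubfield L)), OrbitalMeasureFamily ((UnitaryGroup.cmDatum L 3 H').Local v))
    (mGi : OrbitalMeasureFamily (UnitaryGroup.arch (↥(maximalRealSubfield L)) L (IsCMField.complexConj L) 3 H'))
    (hadm : ∀ v, (mG v).IsAdmissibleOn fun x => IsRegularElt (x.val : GL (Fin 3) (UnitaryGroup.LocalRing L v)))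
    (hadmA : mGi.IsAdmissibleOn fun a => IsRegularElt (a.val : GL (Fin 3) (mixedEmbedding.mixedSpace L)))
    (hnormγ : ∃ S₀ : Finset (HeightOneSpectrum (𝓞 ↥(maximalRealSubfield L))),
      UnitaryGroup.IsNormalisedOff L 3 H' mG ((UnitaryGroup.cmDatum L 3 H').toAdelic γ₀) S₀)
    (hnorm : ∀ p : MatchingAdele L H' γH, ∃ S₀ : Finset (HeightOneSpectrum (𝓞 ↥(maximalRealSubfield L))),
      UnitaryGroup.IsNormalisedOff L 3 H' mG p.adele S₀)
    (T : UnitaryGroup.PureTensor L 3 H') (hT : T.IsTest)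
    (hFi : ∀ c ∈ adelicStableClassesOver L H' γH, Integrable
      (descConj (Quotient.out c : (UnitaryGroup.cmDatum L 3 H').Adelic)
        (Subgroup.centralizer ({(Quotient.out c : (UnitaryGroup.cmDatum L 3 H').Adelic)} : Set (UnitaryGroup.cmDatum L 3 H').Adelic))
        (centralizer_comm _) T.eval)
      (UnitaryGroup.OrbitalMeasureFamily.ofLocalAdelic L 3 H' mG mGi c))
    (mH : ∀ v : HeightOneSpectrum (𝓞 ↥(maximalRealSubfield L)), OrbitalMeasureFamily (pairLocal L (Matrix.of fun i j : Fin 2 => if i.val + j.val + 1 = 2 then (1 : L) else 0) (Matrix.of fun i j : Fin 1 => if i.val + j.val + 1 = 1 then (1 : L) else 0) v))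
    (mHi : OrbitalMeasureFamily (pairArch L (Matrix.of fun i j : Fin 2 => if i.val + j.val + 1 = 2 then (1 : L) else 0) (Matrix.of fun i j : Fin 1 => if i.val + j.val + 1 = 1 then (1 : L) else 0)))
    (hadmH : ∀ v, (mH v).IsAdmissibleOn (IsLocalGRegular L v)) (hadmAH : mHi.IsAdmissibleOn (IsArchGRegular L))
    (hnormH : ∀ p : MatchingAdeleH L γH, ∃ S₀ : Finset (HeightOneSpectrum (𝓞 ↥(maximalRealSubfield L))), IsNormalisedOffPair L (Matrix.of fun i j : Fin 2 => if i.val + j.val + 1 = 2 then (1 : L) else 0) (Matrix.of fun i j : Fin 1 => if i.val + j.val + 1 = 1 then (1 : L) else 0) mH p.adele S₀)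
    (hP : ∀ᶠ v in cofinite, ∀ g : (UnitaryGroup.cmDatum L 2 (Matrix.of fun i j : Fin 2 => if i.val + j.val + 1 = 2 then (1 : L) else 0)).Local v,
      g ∈ UnitaryGroup.cmLocalIntegralLevel L 2 (Matrix.of fun i j : Fin 2 => if i.val + j.val + 1 = 2 then (1 : L) else 0) v →
        IsStablyConj (UnitaryGroup.conjLocal L (IsCMField.complexConj L) v) ((UnitaryGroup.adelicForm L 2 (Matrix.of fun i j : Fin 2 => if i.val + j.val + 1 = 2 then (1 : L) else 0)).map (UnitaryGroup.adeleToLocal L v))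
            ((UnitaryGroup.cmDatum L 2 (Matrix.of fun i j : Fin 2 => if i.val + j.val + 1 = 2 then (1 : L) else 0)).toLocal v ((UnitaryGroup.cmDatum L 2 (Matrix.of fun i j : Fin 2 => if i.val + j.val + 1 = 2 then (1 : L) else 0)).toAdelic γH.1)) g →
          ∃ k ∈ UnitaryGroup.cmLocalIntegralLevel L 2 (Matrix.of fun i j : Fin 2 => if i.val + j.val + 1 = 2 then (1 : L) else 0) v,
            k * (UnitaryGroup.cmDatum L 2 (Matrix.of fun i j : Fin 2 => if i.val + j.val + 1 = 2 then (1 : L) else 0)).toLocal v ((UnitaryGroup.cmDatum L 2 (Matrix.of fun i j : Fin 2 => if i.val + j.val + 1 = 2 then (1 : L) else 0)).toAdelic γH.1) * k⁻¹ = g)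
    (TH : PureTensor₂ L (Matrix.of fun i j : Fin 2 => if i.val + j.val + 1 = 2 then (1 : L) else 0) (Matrix.of fun i j : Fin 1 => if i.val + j.val + 1 = 1 then (1 : L) else 0)) (hTH : TH.IsUnramified₂) (hTc : ∀ v ∈ TH.S, HasCompactSupport (TH.loc v)) (hTa : HasCompactSupport TH.arch)
    (hFiH : ∀ c ∈ adelicStableClassesOverH L γH, Integrable
      (descConj (Quotient.out c : pairAdelic L (Matrix.of fun i j : Fin 2 => if i.val + j.val + 1 = 2 then (1 : L) else 0) (Matrix.of fun i j : Fin 1 => if i.val + j.val + 1 = 1 then (1 : L) else 0))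
        (Subgroup.centralizer ({(Quotient.out c : pairAdelic L (Matrix.of fun i j : Fin 2 => if i.val + j.val + 1 = 2 then (1 : L) else 0) (Matrix.of fun i j : Fin 1 => if i.val + j.val + 1 = 1 then (1 : L) else 0))} : Set (pairAdelic L (Matrix.of fun i j : Fin 2 => if i.val + j.val + 1 = 2 then (1 : L) else 0) (Matrix.of fun i j : Fin 1 => if i.val + j.val + 1 = 1 then (1 : L) else 0))))
        (centralizer_comm _) TH.eval)
      (OrbitalMeasureFamily.ofLocalAdelicPair L (Matrix.of fun i j : Fin 2 => if i.val + j.val + 1 = 2 then (1 : L) else 0) (Matrix.of fun i j : Fin 1 => if i.val + j.val + 1 = 1 then (1 : L) else 0) mH mHi c))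
    (h1 : ∃ S₂ : Finset (HeightOneSpectrum (𝓞 ↥(maximalRealSubfield L))),
      ∀ v, v ∉ S₂ → classOrbitalIntegral (mH v) (TH.loc v) (ConjClasses.mk (rationalComponent L γH v)) = 1)
    (hloc : ∀ v, IsLocalDeltaTransfer L H' v (Δ v) (mH v) (mG v) (TH.loc v) (T.loc v))
    (harch : IsArchDeltaTransfer L H' Tinf mHi mGi TH.arch T.arch) :
    adelicKappaOrbitalIntegralG' L H' γH w (UnitaryGroup.OrbitalMeasureFamily.ofLocalAdelic L 3 H' mG mGi) T.eval =
      adelicStableOrbitalIntegralH L γH (OrbitalMeasureFamily.ofLocalAdelicPair L (Matrix.of fun i j : Fin 2 => if i.val + j.val + 1 = 2 then (1 : L) else 0) (Matrix.of fun i j : Fin 1 => if i.val + j.val + 1 = 1 then (1 : L) else 0) mH mHi) TH.eval :=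
  MatchingAdele.adelicKappaOrbitalIntegralG'_eq_adelicStableOrbitalIntegralH_of_isEulerOnClasses hH' hdet hreg hγ Δ hΔ Tinf w hw mG mGi hadm hadmA hnormγ hnorm T hT
    hFi mH mHi TH.loc TH.arch hloc harch _ _
    (MatchingAdeleH.exists_isEulerOnClasses_ofLocalAdelicPair hreg mH mHi hadmH hadmAH hnormH hP TH hTH hTc hTa hFiH h1)

/-! ## §3 Everything DISCHARGED for canonical families (the engine line's pins (ix′), (xi‴)) -/

/-- **G2 FOR CANONICAL FAMILIES — only pin-shaped hypotheses.**  `G′ = U(H′)`, `H = U(Φ₂) × U(Φ₁)`; `γ_H` rational `G`-regular with rational image `γ₀ ∈ G′(L⁺)`; `Δ`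
a.e. trivial, `Tinf`, class weight `w` reading ★ `adelicFactor`; local Haar measures `ν_v` on `G′_v` with `ν_v(K′_v) = 1` and `νH_v` on `H_v` with `νH_v(K₂,v × K₁,v) = 1`;
local families `mG`, `mH` CANONICAL for them on the (`G`-)regular classes (★ `OrbitalMeasureFamily.IsCanonical`), archimedean families `mGi`, `mHi` admissible on the
(`G`-)regular classes; an `IsTest` pure tensor `T` on `G′(𝐀)` and an unramified pure tensor `T^H` on `H(𝐀)` (compactly supported, continuous bad ∕ archimedean factors)
with `T^H.loc v` a `Δ_v`-transfer of `T.loc v` at EVERY finite `v` and `T^H.arch` a `Δ_∞`-transfer of `T.arch`.  THEN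
`Σᶠ_{c ∈ 𝒞_𝐀(γ_H)} w c · Φ_{ofLocalAdelic mG mGi}(c, T.eval) = Φ^{st,𝐀}_H(γ_H; ofLocalAdelicPair mH mHi; T^H.eval)` — «`Φ^κ(γ, f) = Φ^{st}(γ_H, f^H)`».  Assembly of ★ (E3-G′κ) §5
`…_of_isCanonical`, ★ `archKappaSide_eq_archStableSideH` ∕ `prod_localKappaSide_eq_prod_localStableSideH`, and ★ (E3c-H) `…_of_isCanonical'`.
[cite: Rogawski1990, §4.3 (4.3.1)–(4.3.3) pp. 43–44; §4.9 p. 54; §14.3 pp. 233–234; §14.5 Thm. 14.5.1 (a) p. 238] [cite: Kottwitz1986, Prop. 7.1, Cor. 7.3] [cite: Langlands1983] -/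
theorem MatchingAdele.adelicKappaOrbitalIntegralG'_ofLocalAdelic_eq_adelicStableOrbitalIntegralH_of_isCanonical
      [∀ h : pairAdelic L (Matrix.of fun i j : Fin 2 => if i.val + j.val + 1 = 2 then (1 : L) else 0) (Matrix.of fun i j : Fin 1 => if i.val + j.val + 1 = 1 then (1 : L) else 0), BorelSpace (pairAdelic L (Matrix.of fun i j : Fin 2 => if i.val + j.val + 1 = 2 then (1 : L) else 0) (Matrix.of fun i j : Fin 1 => if i.val + j.val + 1 = 1 then (1 : L) else 0) ⧸ Subgroup.centralizer ({h} : Set (pairAdelic L (Matrix.of fun i j : Fin 2 => if i.val + j.val + 1 = 2 then (1 : L) else 0) (Matrix.of fun i j : Fin 1 => if i.val + j.val + 1 = 1 then (1 : L) else 0))))]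
    [∀ (v : HeightOneSpectrum (𝓞 ↥(maximalRealSubfield L))) (x : pairLocal L (Matrix.of fun i j : Fin 2 => if i.val + j.val + 1 = 2 then (1 : L) else 0) (Matrix.of fun i j : Fin 1 => if i.val + j.val + 1 = 1 then (1 : L) else 0) v),
      BorelSpace (pairLocal L (Matrix.of fun i j : Fin 2 => if i.val + j.val + 1 = 2 then (1 : L) else 0) (Matrix.of fun i j : Fin 1 => if i.val + j.val + 1 = 1 then (1 : L) else 0) v ⧸ Subgroup.centralizer ({x} : Set (pairLocal L (Matrix.of fun i j : Fin 2 => if i.val + j.val + 1 = 2 then (1 : L) else 0) (Matrix.of fun i j : Fin 1 => if i.val + j.val + 1 = 1 then (1 : L) else 0) v)))]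
    [∀ a : pairArch L (Matrix.of fun i j : Fin 2 => if i.val + j.val + 1 = 2 then (1 : L) else 0) (Matrix.of fun i j : Fin 1 => if i.val + j.val + 1 = 1 then (1 : L) else 0), BorelSpace (pairArch L (Matrix.of fun i j : Fin 2 => if i.val + j.val + 1 = 2 then (1 : L) else 0) (Matrix.of fun i j : Fin 1 => if i.val + j.val + 1 = 1 then (1 : L) else 0) ⧸ Subgroup.centralizer ({a} : Set (pairArch L (Matrix.of fun i j : Fin 2 => if i.val + j.val + 1 = 2 then (1 : L) else 0) (Matrix.of fun i j : Fin 1 => if i.val + j.val + 1 = 1 then (1 : L) else 0))))]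
    (hH' : (H'.map (cmConjRingHom L))ᵀ = H') (hdet : H'.det ≠ 0)
    (hreg : IsGRegular (cmConjRingHom L) (Matrix.of fun i j : Fin 2 => if i.val + j.val + 1 = 2 then (1 : L) else 0) (Matrix.of fun i j : Fin 1 => if i.val + j.val + 1 = 1 then (1 : L) else 0) (Matrix.of fun i j : Fin 3 => if i.val + j.val + 1 = 3 then (1 : L) else 0) endoForm_antidiagOne γH)
    {γ₀ : (UnitaryGroup.cmDatum L 3 H').Rational} (hγ : IsNormPair L H' γH γ₀)
    (Δ : ∀ v : HeightOneSpectrum (𝓞 ↥(maximalRealSubfield L)), LocalTransferFactor L H' v) (hΔ : IsAlmostEverywhereTrivial L H' Δ)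
    (Tinf : ArchTransferFactor L H')
    (w : ConjClasses (UnitaryGroup.cmDatum L 3 H').Adelic → ℂ)
    (hw : ∀ p : MatchingAdele L H' γH, w (ConjClasses.mk p.adele) = adelicFactor L H' Δ Tinf.Δ γH p)
    [∀ v : HeightOneSpectrum (𝓞 ↥(maximalRealSubfield L)), MeasurableSpace ((UnitaryGroup.cmDatum L 3 H').Local v)]
    [∀ v : HeightOneSpectrum (𝓞 ↥(maximalRealSubfield L)), BorelSpace ((UnitaryGroup.cmDatum L 3 H').Local v)]
    (ν : ∀ v : HeightOneSpectrum (𝓞 ↥(maximalRealSubfield L)), Measure ((UnitaryGroup.cmDatum L 3 H').Local v))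
    [∀ v, (ν v).IsHaarMeasure] [∀ v, (ν v).IsMulRightInvariant]
    (hν : ∀ v, ν v (UnitaryGroup.cmLocalIntegralLevel L 3 H' v) = 1)
    (mG : ∀ v : HeightOneSpectrum (𝓞 ↥(maximalRealSubfield L)), OrbitalMeasureFamily ((UnitaryGroup.cmDatum L 3 H').Local v))
    (hcan : ∀ v, (mG v).IsCanonical (fun x => IsRegularElt (x.val : GL (Fin 3) (UnitaryGroup.LocalRing L v))) (ν v))
    (mGi : OrbitalMeasureFamily (UnitaryGroup.arch (↥(maximalRealSubfield L)) L (IsCMField.complexConj L) 3 H'))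
    (hadmA : mGi.IsAdmissibleOn fun a => IsRegularElt (a.val : GL (Fin 3) (mixedEmbedding.mixedSpace L)))
    (T : UnitaryGroup.PureTensor L 3 H') (hT : T.IsTest)
    [∀ v : HeightOneSpectrum (𝓞 ↥(maximalRealSubfield L)), MeasurableSpace (pairLocal L (Matrix.of fun i j : Fin 2 => if i.val + j.val + 1 = 2 then (1 : L) else 0) (Matrix.of fun i j : Fin 1 => if i.val + j.val + 1 = 1 then (1 : L) else 0) v)]
    [∀ v : HeightOneSpectrum (𝓞 ↥(maximalRealSubfield L)), BorelSpace (pairLocal L (Matrix.of fun i j : Fin 2 => if i.val + j.val + 1 = 2 then (1 : L) else 0) (Matrix.of fun i j : Fin 1 => if i.val + j.val + 1 = 1 then (1 : L) else 0) v)]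
    (νH : ∀ v : HeightOneSpectrum (𝓞 ↥(maximalRealSubfield L)), Measure (pairLocal L (Matrix.of fun i j : Fin 2 => if i.val + j.val + 1 = 2 then (1 : L) else 0) (Matrix.of fun i j : Fin 1 => if i.val + j.val + 1 = 1 then (1 : L) else 0) v))
    [∀ v, (νH v).IsHaarMeasure] [∀ v, (νH v).IsMulRightInvariant]
    (hνH : ∀ v, νH v ((UnitaryGroup.cmLocalIntegralLevel L 2 (Matrix.of fun i j : Fin 2 => if i.val + j.val + 1 = 2 then (1 : L) else 0) v : Set ((UnitaryGroup.cmDatum L 2 (Matrix.of fun i j : Fin 2 => if i.val + j.val + 1 = 2 then (1 : L) else 0)).Local v)) ×ˢ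
      (UnitaryGroup.cmLocalIntegralLevel L 1 (Matrix.of fun i j : Fin 1 => if i.val + j.val + 1 = 1 then (1 : L) else 0) v : Set ((UnitaryGroup.cmDatum L 1 (Matrix.of fun i j : Fin 1 => if i.val + j.val + 1 = 1 then (1 : L) else 0)).Local v))) = 1)
    (mH : ∀ v : HeightOneSpectrum (𝓞 ↥(maximalRealSubfield L)), OrbitalMeasureFamily (pairLocal L (Matrix.of fun i j : Fin 2 => if i.val + j.val + 1 = 2 then (1 : L) else 0) (Matrix.of fun i j : Fin 1 => if i.val + j.val + 1 = 1 then (1 : L) else 0) v))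
    (mHi : OrbitalMeasureFamily (pairArch L (Matrix.of fun i j : Fin 2 => if i.val + j.val + 1 = 2 then (1 : L) else 0) (Matrix.of fun i j : Fin 1 => if i.val + j.val + 1 = 1 then (1 : L) else 0)))
    (hadmH : ∀ v, (mH v).IsAdmissibleOn (IsLocalGRegular L v)) (hcanH : ∀ v, (mH v).IsCanonical (IsLocalGRegular L v) (νH v))
    (hadmAH : mHi.IsAdmissibleOn (IsArchGRegular L))
    (TH : PureTensor₂ L (Matrix.of fun i j : Fin 2 => if i.val + j.val + 1 = 2 then (1 : L) else 0) (Matrix.of fun i j : Fin 1 => if i.val + j.val + 1 = 1 then (1 : L) else 0)) (hTH : TH.IsUnramified₂) (hTc : ∀ v ∈ TH.S, HasCompactSupport (TH.loc v)) (hTa : HasCompactSupport TH.arch)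
    (hTc' : ∀ v ∈ TH.S, Continuous (TH.loc v)) (hTa' : Continuous TH.arch)
    (hloc : ∀ v, IsLocalDeltaTransfer L H' v (Δ v) (mH v) (mG v) (TH.loc v) (T.loc v))
    (harch : IsArchDeltaTransfer L H' Tinf mHi mGi TH.arch T.arch) :
    adelicKappaOrbitalIntegralG' L H' γH w (UnitaryGroup.OrbitalMeasureFamily.ofLocalAdelic L 3 H' mG mGi) T.eval =
      adelicStableOrbitalIntegralH L γH (OrbitalMeasureFamily.ofLocalAdelicPair L (Matrix.of fun i j : Fin 2 => if i.val + j.val + 1 = 2 then (1 : L) else 0) (Matrix.of fun i j : Fin 1 => if i.val + j.val + 1 = 1 then (1 : L) else 0) mH mHi) TH.eval := by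
  classical
  obtain ⟨S₁, hS₁⟩ := MatchingAdele.exists_adelicKappaOrbitalIntegralG'_ofLocalAdelic_eq_of_isCanonical hH' hdet hreg hγ Δ hΔ Tinf w hw ν hν mG hcan mGi hadmA T hT
  obtain ⟨S₂, hS₂⟩ := MatchingAdeleH.exists_isEulerOnClasses_ofLocalAdelicPair_of_isCanonical' νH hνH hreg mH mHi hadmH hcanH hadmAH TH hTH hTc hTa hTc' hTa'
  have h₁ := hS₁ (S₁ ∪ S₂) Finset.subset_union_left
  have h₂ := hS₂ (S₁ ∪ S₂) Finset.subset_union_right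
  rw [isEulerOnClasses_iff] at h₂
  rw [h₁, archKappaSide_eq_archStableSideH harch hreg, prod_localKappaSide_eq_prod_localStableSideH (S₁ ∪ S₂) hloc hreg]
  unfold adelicStableOrbitalIntegralH
  rw [h₂]
  rfl

/-! ## §4 The class weight as print writes it: `w [γ̄] = κ(obs γ̄)` under (4.3.3) -/

/-- **G2 with the `κ ∘ obs` weight** — if the class weight reads `κ(obs γ̄)` on the matching adèles and the collection `(Δ, Δ_∞)` satisfies the GLOBAL TRANSFER-FACTOR IDENTITY
(4.3.3) ★ `GlobalKappaFormula L H′ Δ Tinf.Δ obs κ` («`Δ_{G∕H}(γ_H, γ̄) = κ(obs γ̄)`», a NAMED FACT, here an explicit hypothesis), then the canonical G2 identity holds for that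
weight: `Σᶠ_{c ∈ 𝒞_𝐀(γ_H)} κ(obs c) · Φ(c, T.eval) = Φ^{st,𝐀}_H(γ_H; T^H.eval)` — print's `Φ^κ(γ, f) = Σ_δ κ(obs δ) Φ(δ, f) = Φ^{st}(γ_H, f^H)`.
[cite: Rogawski1990, §4.3 (4.3.2)–(4.3.3) pp. 43–44; §14.5 Thm. 14.5.1 (a) p. 238] [cite: Kottwitz1986, Prop. 7.1] -/
theorem MatchingAdele.adelicKappaOrbitalIntegralG'_ofLocalAdelic_eq_adelicStableOrbitalIntegralH_of_globalKappaFormula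
      [∀ h : pairAdelic L (Matrix.of fun i j : Fin 2 => if i.val + j.val + 1 = 2 then (1 : L) else 0) (Matrix.of fun i j : Fin 1 => if i.val + j.val + 1 = 1 then (1 : L) else 0), BorelSpace (pairAdelic L (Matrix.of fun i j : Fin 2 => if i.val + j.val + 1 = 2 then (1 : L) else 0) (Matrix.of fun i j : Fin 1 => if i.val + j.val + 1 = 1 then (1 : L) else 0) ⧸ Subgroup.centralizer ({h} : Set (pairAdelic L (Matrix.of fun i j : Fin 2 => if i.val + j.val + 1 = 2 then (1 : L) else 0) (Matrix.of fun i j : Fin 1 => if i.val + j.val + 1 = 1 then (1 : L) else 0))))]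
    [∀ (v : HeightOneSpectrum (𝓞 ↥(maximalRealSubfield L))) (x : pairLocal L (Matrix.of fun i j : Fin 2 => if i.val + j.val + 1 = 2 then (1 : L) else 0) (Matrix.of fun i j : Fin 1 => if i.val + j.val + 1 = 1 then (1 : L) else 0) v),
      BorelSpace (pairLocal L (Matrix.of fun i j : Fin 2 => if i.val + j.val + 1 = 2 then (1 : L) else 0) (Matrix.of fun i j : Fin 1 => if i.val + j.val + 1 = 1 then (1 : L) else 0) v ⧸ Subgroup.centralizer ({x} : Set (pairLocal L (Matrix.of fun i j : Fin 2 => if i.val + j.val + 1 = 2 then (1 : L) else 0) (Matrix.of fun i j : Fin 1 => if i.val + j.val + 1 = 1 then (1 : L) else 0) v)))]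
    [∀ a : pairArch L (Matrix.of fun i j : Fin 2 => if i.val + j.val + 1 = 2 then (1 : L) else 0) (Matrix.of fun i j : Fin 1 => if i.val + j.val + 1 = 1 then (1 : L) else 0), BorelSpace (pairArch L (Matrix.of fun i j : Fin 2 => if i.val + j.val + 1 = 2 then (1 : L) else 0) (Matrix.of fun i j : Fin 1 => if i.val + j.val + 1 = 1 then (1 : L) else 0) ⧸ Subgroup.centralizer ({a} : Set (pairArch L (Matrix.of fun i j : Fin 2 => if i.val + j.val + 1 = 2 then (1 : L) else 0) (Matrix.of fun i j : Fin 1 => if i.val + j.val + 1 = 1 then (1 : L) else 0))))]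
    (hH' : (H'.map (cmConjRingHom L))ᵀ = H') (hdet : H'.det ≠ 0)
    (hreg : IsGRegular (cmConjRingHom L) (Matrix.of fun i j : Fin 2 => if i.val + j.val + 1 = 2 then (1 : L) else 0) (Matrix.of fun i j : Fin 1 => if i.val + j.val + 1 = 1 then (1 : L) else 0) (Matrix.of fun i j : Fin 3 => if i.val + j.val + 1 = 3 then (1 : L) else 0) endoForm_antidiagOne γH)
    {γ₀ : (UnitaryGroup.cmDatum L 3 H').Rational} (hγ : IsNormPair L H' γH γ₀)
    (Δ : ∀ v : HeightOneSpectrum (𝓞 ↥(maximalRealSubfield L)), LocalTransferFactor L H' v) (hΔ : IsAlmostEverywhereTrivial L H' Δ)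
    (Tinf : ArchTransferFactor L H')
    {A : Type} [AddCommGroup A] (obs : MatchingAdele L H' γH → A) (κ : AddChar A ℂ) (hκ : GlobalKappaFormula L H' Δ Tinf.Δ obs κ)
    (w : ConjClasses (UnitaryGroup.cmDatum L 3 H').Adelic → ℂ)
    (hw : ∀ p : MatchingAdele L H' γH, w (ConjClasses.mk p.adele) = κ (obs p))
    [∀ v : HeightOneSpectrum (𝓞 ↥(maximalRealSubfield L)), MeasurableSpace ((UnitaryGroup.cmDatum L 3 H').Local v)]
    [∀ v : HeightOneSpectrum (𝓞 ↥(maximalRealSubfield L)), BorelSpace ((UnitaryGroup.cmDatum L 3 H').Local v)]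
    (ν : ∀ v : HeightOneSpectrum (𝓞 ↥(maximalRealSubfield L)), Measure ((UnitaryGroup.cmDatum L 3 H').Local v))
    [∀ v, (ν v).IsHaarMeasure] [∀ v, (ν v).IsMulRightInvariant]
    (hν : ∀ v, ν v (UnitaryGroup.cmLocalIntegralLevel L 3 H' v) = 1)
    (mG : ∀ v : HeightOneSpectrum (𝓞 ↥(maximalRealSubfield L)), OrbitalMeasureFamily ((UnitaryGroup.cmDatum L 3 H').Local v))
    (hcan : ∀ v, (mG v).IsCanonical (fun x => IsRegularElt (x.val : GL (Fin 3) (UnitaryGroup.LocalRing L v))) (ν v))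
    (mGi : OrbitalMeasureFamily (UnitaryGroup.arch (↥(maximalRealSubfield L)) L (IsCMField.complexConj L) 3 H'))
    (hadmA : mGi.IsAdmissibleOn fun a => IsRegularElt (a.val : GL (Fin 3) (mixedEmbedding.mixedSpace L)))
    (T : UnitaryGroup.PureTensor L 3 H') (hT : T.IsTest)
    [∀ v : HeightOneSpectrum (𝓞 ↥(maximalRealSubfield L)), MeasurableSpace (pairLocal L (Matrix.of fun i j : Fin 2 => if i.val + j.val + 1 = 2 then (1 : L) else 0) (Matrix.of fun i j : Fin 1 => if i.val + j.val + 1 = 1 then (1 : L) else 0) v)]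
    [∀ v : HeightOneSpectrum (𝓞 ↥(maximalRealSubfield L)), BorelSpace (pairLocal L (Matrix.of fun i j : Fin 2 => if i.val + j.val + 1 = 2 then (1 : L) else 0) (Matrix.of fun i j : Fin 1 => if i.val + j.val + 1 = 1 then (1 : L) else 0) v)]
    (νH : ∀ v : HeightOneSpectrum (𝓞 ↥(maximalRealSubfield L)), Measure (pairLocal L (Matrix.of fun i j : Fin 2 => if i.val + j.val + 1 = 2 then (1 : L) else 0) (Matrix.of fun i j : Fin 1 => if i.val + j.val + 1 = 1 then (1 : L) else 0) v))
    [∀ v, (νH v).IsHaarMeasure] [∀ v, (νH v).IsMulRightInvariant]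
    (hνH : ∀ v, νH v ((UnitaryGroup.cmLocalIntegralLevel L 2 (Matrix.of fun i j : Fin 2 => if i.val + j.val + 1 = 2 then (1 : L) else 0) v : Set ((UnitaryGroup.cmDatum L 2 (Matrix.of fun i j : Fin 2 => if i.val + j.val + 1 = 2 then (1 : L) else 0)).Local v)) ×ˢ
      (UnitaryGroup.cmLocalIntegralLevel L 1 (Matrix.of fun i j : Fin 1 => if i.val + j.val + 1 = 1 then (1 : L) else 0) v : Set ((UnitaryGroup.cmDatum L 1 (Matrix.of fun i j : Fin 1 => if i.val + j.val + 1 = 1 then (1 : L) else 0)).Local v))) = 1)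
    (mH : ∀ v : HeightOneSpectrum (𝓞 ↥(maximalRealSubfield L)), OrbitalMeasureFamily (pairLocal L (Matrix.of fun i j : Fin 2 => if i.val + j.val + 1 = 2 then (1 : L) else 0) (Matrix.of fun i j : Fin 1 => if i.val + j.val + 1 = 1 then (1 : L) else 0) v))
    (mHi : OrbitalMeasureFamily (pairArch L (Matrix.of fun i j : Fin 2 => if i.val + j.val + 1 = 2 then (1 : L) else 0) (Matrix.of fun i j : Fin 1 => if i.val + j.val + 1 = 1 then (1 : L) else 0)))
    (hadmH : ∀ v, (mH v).IsAdmissibleOn (IsLocalGRegular L v)) (hcanH : ∀ v, (mH v).IsCanonical (IsLocalGRegular L v) (νH v))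
    (hadmAH : mHi.IsAdmissibleOn (IsArchGRegular L))
    (TH : PureTensor₂ L (Matrix.of fun i j : Fin 2 => if i.val + j.val + 1 = 2 then (1 : L) else 0) (Matrix.of fun i j : Fin 1 => if i.val + j.val + 1 = 1 then (1 : L) else 0)) (hTH : TH.IsUnramified₂) (hTc : ∀ v ∈ TH.S, HasCompactSupport (TH.loc v)) (hTa : HasCompactSupport TH.arch)
    (hTc' : ∀ v ∈ TH.S, Continuous (TH.loc v)) (hTa' : Continuous TH.arch)
    (hloc : ∀ v, IsLocalDeltaTransfer L H' v (Δ v) (mH v) (mG v) (TH.loc v) (T.loc v))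
    (harch : IsArchDeltaTransfer L H' Tinf mHi mGi TH.arch T.arch) :
    adelicKappaOrbitalIntegralG' L H' γH w (UnitaryGroup.OrbitalMeasureFamily.ofLocalAdelic L 3 H' mG mGi) T.eval =
      adelicStableOrbitalIntegralH L γH (OrbitalMeasureFamily.ofLocalAdelicPair L (Matrix.of fun i j : Fin 2 => if i.val + j.val + 1 = 2 then (1 : L) else 0) (Matrix.of fun i j : Fin 1 => if i.val + j.val + 1 = 1 then (1 : L) else 0) mH mHi) TH.eval :=
  MatchingAdele.adelicKappaOrbitalIntegralG'_ofLocalAdelic_eq_adelicStableOrbitalIntegralH_of_isCanonical hH' hdet hreg hγ Δ hΔ Tinf w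
    (fun p => (hw p).trans (hκ p).symm) ν hν mG hcan mGi hadmA T hT νH hνH mH mHi hadmH hcanH hadmAH TH hTH hTc hTa hTc' hTa' hloc harch

end Assembly

end Literature.NumberTheory.Rogawski1990

end
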